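import Literature.Topology.FourManifolds.TrisectionFunctorSPC4
import Literature.Topology.FourManifolds.TrisectionEulerProofs
import Literature.Topology.FourManifolds.TrisectionFunctorGKVanKampen
import Literature.Topology.FourManifolds.FlowerMelon
import Summits.SmoothPoincare4.SmoothPoincare4.Theses.CongruenceShadows

/-!
# Sketch — crux-ideate stmt-SmoothPoincare4-10894 (AgkCor6Sufficiency), ideator 3, round 1

First lemmas of the three idea cards (must elaborate; proofs optional):

* card `reducing-sphere-descent`: `SphereRecognition` (one-manifold recognition against the
  standard triple) and the PROVED reduction
  `agkCor6Sufficiency_of_recognition : SphereRecognition → GK Thm 4 → (c′) → AgkCor6Sufficiency`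
  — the general two-manifold rigidity leaf (b′) and the leaf (d′) drop out of the crux.
* card `heegaard-kirby-shadow`: `goeritzNormalForm` — fed a kernel triple whose first two kernels
  are the standard Heegaard pair of the standard `S⁴` triple, the hypothesis of the crux returns an
  automorphism FIXING the two standard kernels (algebraic Goeritz element); statement only.
* card `binary-product-nielsen`: `DehnNielsenCentralSurface` (realisation of abstract automorphisms
  of `S_g` by based homeomorphisms of the central surface) and the split
  `rigidity_of_geometric_and_dnb : GeometricRigidity → DehnNielsenCentralSurface → (b′)`.
-/

noncomputable section

open Set ContinuousMap
open scoped Manifold ContDiff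

namespace Summit.SmoothPoincare4.SmoothPoincare4.Cruxes.AgkCor6Sufficiency.Sketch

open Literature.Topology.FourManifolds

local notation "𝕊⁴" => (Metric.sphere (0 : EuclideanSpace ℝ (Fin 5)) 1)

/-! ### Card `reducing-sphere-descent` -/

/-- **One-manifold recognition against the standard triple.** A closed connected oriented smooth
4-manifold carrying a balanced Gay–Kirby trisection whose kernel triple (any base point, any
marking) is isomorphic to the `m`-fold stabilised genus-3 `S⁴` triple is diffeomorphic to `S⁴`.
(To be proved by induction on `m` through reducing curves / trisected reducing spheres, base
case = genus ≤ 3 via Cerf `Γ₄ = 0`.) -/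
def SphereRecognition : Prop :=
  ∀ (X : Type) [TopologicalSpace X] [T2Space X] [SecondCountableTopology X]
    [ChartedSpace (EuclideanSpace ℝ (Fin 4)) X] [IsManifold (𝓡 4) ∞ X] [CompactSpace X]
    [ConnectedSpace X] (_ : SmoothOrientation (𝓡 4) X) (G k m : ℕ) (S : Fin 3 → Set X)
    (h : IsBalancedGKTrisection X G k S) (x₀ : centralSurface S)
    (μ : SurfaceGroup G ≃* FundamentalGroup (centralSurface S) x₀) (e : 3 + 3 * m = G),
    TrisectionKernels.Iso (groupGKTrisectionOf h x₀ μ) ((s4Kernels.stabilizeIter m).cast e) →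
      Nonempty (X ≃ₘ⟮𝓡 4, 𝓡 4⟯ 𝕊⁴)

/-- **The crux from recognition + existence + stabilisation only** (no two-manifold rigidity
(b′), no (d′)): mirror of `spc4_of_forall_isStablyTrivial_of_facts` with its last two steps
replaced by `SphereRecognition`. -/
theorem agkCor6Sufficiency_of_recognition (hR : SphereRecognition)
    (hGK : exists_isBalancedGKTrisection.{0}) (hc : exists_stabilized_gkTrisection.{0}) :
    Theses.CongruenceShadows.AgkCor6Sufficiency := by
  intro hst M _ _ _ _ _ e
  haveI : CompactSpace M := compactSpace_of_homotopyEquiv_sphere_four_holds M e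
  obtain ⟨o⟩ := isOrientable_of_homotopyEquiv_sphere_four_holds M e
  haveI : SimplyConnectedSpace 𝕊⁴ := simplyConnectedSpace_sphere_four_holds
  haveI : SimplyConnectedSpace M := e.simplyConnectedSpace
  obtain ⟨g, k, S, -, hS⟩ := hGK M o
  obtain rfl : g = 3 * k := gkTrisection_genus_eq_sum_of_homotopyEquiv_sphere_holds.balanced M o hS e
  obtain ⟨x₀, ⟨μ⟩⟩ := exists_marking_centralSurface_of_gkTrisection_holds M o (3 * k) k S hS
  have hK : IsGroupTrisection (3 * k) k (PUnit : Type) (groupGKTrisectionOf hS x₀ μ) :=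
    (isGroupTrisection_groupGKTrisectionOf_holds M o (3 * k) k S hS x₀ μ).punit_of_subsingleton
  obtain ⟨n, m, hnm, hiso⟩ := hst k _ hK
  obtain ⟨Sₙ, hₙ, xₙ, μₙ, hEq⟩ := exists_gkTrisection_stabilizeIter hc M o hS x₀ μ n
  rw [← hEq] at hiso
  exact hR M o (3 * k + 3 * n) (k + n) m Sₙ hₙ xₙ μₙ hnm hiso

/-- The same, phrased against the shared decl of route `GroupTrisection` (identical signature). -/
theorem agkCor6Sufficiency_of_recognition' (hR : SphereRecognition)
    (hGK : exists_isBalancedGKTrisection.{0}) (hc : exists_stabilized_gkTrisection.{0}) :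
    (∀ (k : ℕ) (K : TrisectionKernels (3 * k)),
        IsGroupTrisection (3 * k) k (PUnit : Type) K → K.IsStablyTrivial) →
      ∀ (M : Type) [TopologicalSpace M] [T2Space M] [SecondCountableTopology M],
        ContinuousMap.HomotopyEquiv.NonemptyDiffeomorphSphere M 4 :=
  agkCor6Sufficiency_of_recognition hR hGK hc

/-! ### Card `heegaard-kirby-shadow` -/

/-- **Algebraic Goeritz normal form of the hypothesis.** If the first two kernels of a genus
`3+3m` kernel triple ARE the first two kernels of the standard `S⁴` triple (the Heegaard pair of
`#^{m+1}(S¹×S²)` read on a Heegaard–Kirby surface), stable triviality yields, after `n` further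
stabilisations, an automorphism of `S_{3+3m+3n}` fixing both standard kernels and carrying the
standard third kernel onto the third kernel (pure bookkeeping: stabilisation acts kernelwise and
`(N_m).stabilizeIter n = N_{m+n}` up to cast). Statement only. -/
theorem goeritzNormalForm (m : ℕ) (K : TrisectionKernels (3 + 3 * m))
    (h0 : K 0 = s4Kernels.stabilizeIter m 0) (h1 : K 1 = s4Kernels.stabilizeIter m 1)
    (hst : K.IsStablyTrivial) :
    ∃ (n : ℕ) (α : SurfaceGroup (3 + 3 * m + 3 * n) ≃* SurfaceGroup (3 + 3 * m + 3 * n)),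
      (∀ i : Fin 3, i ≠ 2 → ((K.stabilizeIter n) i).map α.toMonoidHom = (K.stabilizeIter n) i) ∧
      (((s4Kernels.stabilizeIter m).stabilizeIter n) 2).map α.toMonoidHom = (K.stabilizeIter n) 2 := by
  sorry

/-! ### Card `binary-product-nielsen` -/

/-- **Dehn–Nielsen on the central surface** (Zieschang–Vogt–Coldewey Thm 5.6.2, combinatorial via
binary products): every automorphism of `S_g`, read through a marking of the central surface of a
balanced Gay–Kirby trisection, is induced by a based self-homeomorphism of the central surface. -/
def DehnNielsenCentralSurface : Prop :=
  ∀ (X : Type) [TopologicalSpace X] [T2Space X] [SecondCountableTopology X]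
    [ChartedSpace (EuclideanSpace ℝ (Fin 4)) X] [IsManifold (𝓡 4) ∞ X] [CompactSpace X]
    [ConnectedSpace X] (_ : SmoothOrientation (𝓡 4) X) (g k : ℕ) (S : Fin 3 → Set X)
    (_ : IsBalancedGKTrisection X g k S) (x₀ : centralSurface S)
    (μ : SurfaceGroup g ≃* FundamentalGroup (centralSurface S) x₀)
    (α : SurfaceGroup g ≃* SurfaceGroup g),
    ∃ (φ : centralSurface S ≃ₜ centralSurface S) (hφ : φ x₀ = x₀),
      ∀ γ : SurfaceGroup g,
        FundamentalGroup.mapOfEq (⟨φ, φ.continuous⟩ : C(centralSurface S, centralSurface S)) hφ (μ γ)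
          = μ (α γ)

/-- **Nielsen lifting** (ZVC Thm 5.6.1; = the hypothesis `hN` of
`exists_stabilized_gkTrisection_of_geometric_of_nielsen`, leaf (c′)): every automorphism of the
presented surface group lifts to the free group with the relator going to a conjugate of `r^{±1}`. -/
def NielsenLift : Prop :=
  ∀ (g : ℕ) (α : SurfaceGroup g ≃* SurfaceGroup g),
    ∃ (φ : FreeGroup (surfaceGen g) ≃* FreeGroup (surfaceGen g)) (c : FreeGroup (surfaceGen g))
      (ε : ℤ), (ε = 1 ∨ ε = -1) ∧ φ (surfaceRelator g) = c * surfaceRelator g ^ ε * c⁻¹ ∧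
      ∀ x, PresentedGroup.mk _ (φ x) = α (PresentedGroup.mk _ x)

/-- **Geometric rigidity** (the group-theory-free half of (b′)): two balanced GK-trisected closed
4-manifolds whose central surfaces are related by a based HOMEOMORPHISM carrying each handlebody
kernel onto the corresponding one are diffeomorphic (Dehn's lemma / handlebody extension,
Laudenbach–Poénaru, corner gluing — no automorphisms of `S_g` anywhere). -/
def GeometricRigidity : Prop :=
  ∀ (X : Type) [TopologicalSpace X] [T2Space X] [SecondCountableTopology X]
    [ChartedSpace (EuclideanSpace ℝ (Fin 4)) X] [IsManifold (𝓡 4) ∞ X] [CompactSpace X]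
    [ConnectedSpace X] (_ : SmoothOrientation (𝓡 4) X)
    (X' : Type) [TopologicalSpace X'] [T2Space X'] [SecondCountableTopology X']
    [ChartedSpace (EuclideanSpace ℝ (Fin 4)) X'] [IsManifold (𝓡 4) ∞ X'] [CompactSpace X']
    [ConnectedSpace X'] (_ : SmoothOrientation (𝓡 4) X')
    (g k : ℕ) (S : Fin 3 → Set X) (S' : Fin 3 → Set X')
    (_ : IsBalancedGKTrisection X g k S) (_ : IsBalancedGKTrisection X' g k S')
    (x₀ : centralSurface S) (x₀' : centralSurface S')
    (ψ : centralSurface S ≃ₜ centralSurface S') (hψ : ψ x₀ = x₀'),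
    (∀ i : Fin 3, ((FundamentalGroup.map (centralInclusion S i) x₀).ker).map
        (FundamentalGroup.mapOfEq (⟨ψ, ψ.continuous⟩ : C(centralSurface S, centralSurface S')) hψ)
        = (FundamentalGroup.map (centralInclusion S' i) x₀').ker) →
      Nonempty (X ≃ₘ⟮𝓡 4, 𝓡 4⟯ X')

/-- **The split of leaf (b′)**: geometric rigidity + Dehn–Nielsen on central surfaces give the
tree's rigidity leaf `diffeomorph_of_iso_groupGKTrisectionOf` (statement of the transfer; the
proof is marking bookkeeping: `Iso` via `α` and markings `μ, μ'` give the abstract isomorphism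
`μ' ∘ α ∘ μ⁻¹ : π₁(F, x₀) → π₁(F', x₀')`; DNB on `F'` corrects any based homeomorphism `F → F'`
(one exists: both are genus-`g` surfaces — itself a consequence of the marking fact) to one
inducing it). Statement only. -/
theorem rigidity_of_geometric_and_dnb (hgeo : GeometricRigidity) (hdnb : DehnNielsenCentralSurface)
    (hsurf : ∀ (X : Type) [TopologicalSpace X] [T2Space X] [SecondCountableTopology X]
      [ChartedSpace (EuclideanSpace ℝ (Fin 4)) X] [IsManifold (𝓡 4) ∞ X] [CompactSpace X]
      [ConnectedSpace X] (_ : SmoothOrientation (𝓡 4) X)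
      (X' : Type) [TopologicalSpace X'] [T2Space X'] [SecondCountableTopology X']
      [ChartedSpace (EuclideanSpace ℝ (Fin 4)) X'] [IsManifold (𝓡 4) ∞ X'] [CompactSpace X']
      [ConnectedSpace X'] (_ : SmoothOrientation (𝓡 4) X')
      (g k : ℕ) (S : Fin 3 → Set X) (S' : Fin 3 → Set X')
      (_ : IsBalancedGKTrisection X g k S) (_ : IsBalancedGKTrisection X' g k S')
      (x₀ : centralSurface S) (x₀' : centralSurface S'),
      ∃ ψ : centralSurface S ≃ₜ centralSurface S', ψ x₀ = x₀') :
    diffeomorph_of_iso_groupGKTrisectionOf.{0} := by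
  sorry

end Summit.SmoothPoincare4.SmoothPoincare4.Cruxes.AgkCor6Sufficiency.Sketch

end
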